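import Mathlib
import Summits.QuantumFields.QCD.Theorems.QuarksAsStableActionUnquenchedChessboardBoundStubMarginalRPDet
import Summits.QuantumFields.QCD.Theorems.QuarksAsStableActionDefs
import HarnessLib

/-!
# The bond-diluted, polarised Gram identity, I: the site mask (stubs `stub_torusPeel` /
`stub_sitePeel` of crux stmt-QuantumFields-9735, line Sketch — wave-2 helper 1a)

The bond-diluted Wilson–Dirac operator `D_E` (`bondWilsonDirac`: hops of the bond `b` kept iff
`b ∈ E`) is the Hadamard product of the undiluted operator with the 0/1 **site mask**
`w_E(x, y) = [every bond joining x and y lies in E]` (`bondWilsonDirac_eq_maskMul`, `L ≥ 3`). The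
mask only sees sites, so the whole block analysis of the undiluted chain (helper files 2–5 of
`stub_marginalRP`) passes to `D_E` entrywise: the chirality basis change commutes with the mask
(`det_maskMul_wilsonDiracG_chiral`), the upper/plane blocks get masked (`upperBlockE`,
`planeBlockE`, helper 1b), and under the site reflection the mask of `E` becomes the mask of the
reflected bond set `reflBonds E` (`bondMask_siteTimeNeg`); the diluted Gram identity itself is in
helper 1b.
-/

noncomputable section

open Matrix Complex Finset
open Literature.MathematicalPhysics.QuantumLattice Literature.MathematicalPhysics.QuantumFieldTheory
open Literature.Probability.LatticeModels
open Summit.QuantumFields.QCD.Theorems.QuarksAsStableAction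
open scoped ComplexConjugate BigOperators Kronecker

namespace Summit.QuantumFields.QCD.Theorems.UnquenchedChessboardBoundLine

/-! ## The site mask -/

section Mask

variable {L N : ℕ} [NeZero L] [Fact (1 < L)]

omit [NeZero L] [Fact (1 < L)] in
/-- `x + ê_μ + ê_ν ≠ x` on a torus of side `L ≥ 3`. -/
theorem shift_shift_ne_self (h4 : 4 ≤ L) (x : TorusSite 4 L) (μ ν : Fin 4) :
    Site.shift (Site.shift x μ) ν ≠ x := by
  intro h
  have h1 := congrFun h μ
  by_cases hμν : ν = μ
  · subst hμν
    rw [WilsonRP.shift_apply_self, WilsonRP.shift_apply_self, add_assoc, add_eq_left] at h1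
    have h2 : ((2 : ℕ) : ZMod L) = 0 := by rw [Nat.cast_ofNat, ← h1]; ring
    rw [ZMod.natCast_eq_zero_iff] at h2
    have := Nat.le_of_dvd (by norm_num) h2
    omega
  · rw [WilsonRP.shift_apply_of_ne _ (Ne.symm hμν), WilsonRP.shift_apply_self, add_eq_left] at h1
    haveI : Fact (1 < L) := ⟨by omega⟩
    exact one_ne_zero h1

omit [NeZero L] [Fact (1 < L)] in
/-- **The site mask** of a bond set: `w_E(x, y) = 1` iff every bond joining `x` and `y` lies in `E`
(so `w_E(x, x) = 1`, `w_E(x, y) = 1` for non-adjacent sites, and `w_E(x, x ± ê_μ) = [bond ∈ E]`). -/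
def bondMask (E : Finset (Edge 4 L)) (x y : TorusSite 4 L) : ℂ :=
  if (∀ μ, y = Site.shift x μ → (x, μ) ∈ E) ∧ (∀ μ, x = Site.shift y μ → (y, μ) ∈ E) then 1 else 0

omit [NeZero L] [Fact (1 < L)] in
/-- The mask is symmetric. -/
theorem bondMask_comm (E : Finset (Edge 4 L)) (x y : TorusSite 4 L) : bondMask E x y = bondMask E y x := by
  unfold bondMask
  rw [if_congr and_comm rfl rfl]

omit [NeZero L] [Fact (1 < L)] in
/-- The mask is real. -/
theorem conj_bondMask (E : Finset (Edge 4 L)) (x y : TorusSite 4 L) : conj (bondMask E x y) = bondMask E x y := by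
  unfold bondMask
  split_ifs <;> simp

omit [NeZero L] [Fact (1 < L)] in
/-- Masks of bond sets agreeing on the bonds joining `x` and `y` agree at `(x, y)`. -/
theorem bondMask_congr {E E' : Finset (Edge 4 L)} {x y : TorusSite 4 L}
    (h : ∀ μ, (y = Site.shift x μ → ((x, μ) ∈ E ↔ (x, μ) ∈ E')) ∧ (x = Site.shift y μ → ((y, μ) ∈ E ↔ (y, μ) ∈ E'))) :
    bondMask E x y = bondMask E' x y := by
  have key : ((∀ μ, y = Site.shift x μ → (x, μ) ∈ E) ∧ (∀ μ, x = Site.shift y μ → (y, μ) ∈ E)) ↔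
      ((∀ μ, y = Site.shift x μ → (x, μ) ∈ E') ∧ (∀ μ, x = Site.shift y μ → (y, μ) ∈ E')) :=
    and_congr (forall_congr' fun μ => imp_congr_right fun hμ => (h μ).1 hμ)
      (forall_congr' fun μ => imp_congr_right fun hμ => (h μ).2 hμ)
  unfold bondMask
  rw [if_congr key rfl rfl]

omit [NeZero L] [Fact (1 < L)] in
/-- **Hadamard product with the site mask.** -/
def maskMul (E : Finset (Edge 4 L)) (M : Matrix (TorusSite 4 L × Fin N × Fin 4) (TorusSite 4 L × Fin N × Fin 4) ℂ) :
    Matrix (TorusSite 4 L × Fin N × Fin 4) (TorusSite 4 L × Fin N × Fin 4) ℂ :=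
  Matrix.of fun p q => bondMask E p.1 q.1 * M p q

omit [NeZero L] [Fact (1 < L)] in
/-- **The diluted operator is the masked operator** (`L ≥ 3`: two sites are joined by at most one
bond). -/
theorem bondWilsonDirac_eq_maskMul (h4 : 4 ≤ L) {G : Type*} [Group G] (ρ : G →* Matrix (Fin N) (Fin N) ℂ)
    (E : Finset (Edge 4 L)) (V : GaugeConfig 4 L G) (m r : ℝ) :
    bondWilsonDirac ρ E V m r = maskMul E (wilsonDirac ρ V m r) := by
  haveI : Fact (1 < L) := ⟨by omega⟩
  ext p q
  simp only [bondWilsonDirac_apply, maskMul, wilsonDirac, Matrix.of_apply, bondMask]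
  by_cases hc : (∀ μ, q.1 = Site.shift p.1 μ → (p.1, μ) ∈ E) ∧ (∀ μ, p.1 = Site.shift q.1 μ → (q.1, μ) ∈ E)
  · rw [if_pos hc, one_mul]
    congr 1
    congr 1
    refine Finset.sum_congr rfl fun μ _ => ?_
    congr 1
    · by_cases h : q.1 = Site.shift p.1 μ
      · rw [if_pos ⟨h, hc.1 μ h⟩, if_pos h]
      · rw [if_neg (fun h' => h h'.1), if_neg h]
    · by_cases h : p.1 = Site.shift q.1 μ
      · rw [if_pos ⟨h, hc.2 μ h⟩, if_pos h]
      · rw [if_neg (fun h' => h h'.1), if_neg h]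
  · rw [if_neg hc, zero_mul]
    rw [not_and_or, not_forall, not_forall] at hc
    have hpq : p.1 ≠ q.1 := by
      rcases hc with ⟨μ, hμ⟩ | ⟨μ, hμ⟩ <;> rw [Classical.not_imp] at hμ
      · rw [hμ.1]; exact (shift_ne_self _ _).symm
      · rw [hμ.1]; exact shift_ne_self _ _
    rw [if_neg (fun h => hpq (by rw [h])), zero_sub, neg_eq_zero]
    refine mul_eq_zero.2 (Or.inr (Finset.sum_eq_zero fun ν _ => ?_))
    rcases hc with ⟨μ, hμ⟩ | ⟨μ, hμ⟩ <;> rw [Classical.not_imp] at hμ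
    · rw [if_neg, if_neg, add_zero]
      · rintro ⟨h, -⟩
        rw [hμ.1] at h
        exact shift_shift_ne_self h4 _ _ _ h.symm
      · rintro ⟨h, hE⟩
        rw [hμ.1, shift_eq_shift_iff] at h
        exact hμ.2 (h ▸ hE)
    · rw [if_neg, if_neg, add_zero]
      · rintro ⟨h, hE⟩
        rw [hμ.1, shift_eq_shift_iff] at h
        exact hμ.2 (h ▸ hE)
      · rintro ⟨h, -⟩
        rw [hμ.1] at h
        exact shift_shift_ne_self h4 _ _ _ h.symm

omit [Fact (1 < L)] in
/-- Left spinor lifts commute with the mask. -/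
theorem spinorLift_mul_maskMul (u : Matrix (Fin 4) (Fin 4) ℂ) (E : Finset (Edge 4 L))
    (M : Matrix (TorusSite 4 L × Fin N × Fin 4) (TorusSite 4 L × Fin N × Fin 4) ℂ) :
    spinorLift (L := L) (N := N) u * maskMul E M = maskMul E (spinorLift (L := L) (N := N) u * M) := by
  ext p q
  simp only [spinorLift_mul_apply, maskMul, Matrix.of_apply, Finset.mul_sum]
  exact Finset.sum_congr rfl fun α _ => by ring

omit [Fact (1 < L)] in
/-- Right spinor lifts commute with the mask. -/
theorem maskMul_mul_spinorLift (u : Matrix (Fin 4) (Fin 4) ℂ) (E : Finset (Edge 4 L))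
    (M : Matrix (TorusSite 4 L × Fin N × Fin 4) (TorusSite 4 L × Fin N × Fin 4) ℂ) :
    maskMul E M * spinorLift (L := L) (N := N) u = maskMul E (M * spinorLift (L := L) (N := N) u) := by
  ext p q
  simp only [mul_spinorLift_apply, maskMul, Matrix.of_apply, Finset.mul_sum]
  exact Finset.sum_congr rfl fun α _ => by ring

omit [Fact (1 < L)] in
/-- **The determinant of the masked operator is basis independent.** -/
theorem det_maskMul_wilsonDiracG_chiral {G : Type*} [Group G] (ρ : G →* Matrix (Fin N) (Fin N) ℂ)
    (E : Finset (Edge 4 L)) (V : GaugeConfig 4 L G) (m r : ℝ) :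
    (maskMul E (wilsonDiracG ρ chiralGamma V m r)).det = (maskMul E (wilsonDirac ρ V m r)).det := by
  have h1 : spinorLift (L := L) (N := N) uSpin * spinorLift uInv = 1 := by
    rw [spinorLift_mul_spinorLift, uSpin_mul_uInv]
    simp [spinorLift]
  have key : maskMul E (wilsonDiracG ρ chiralGamma V m r) =
      spinorLift uSpin * maskMul E (wilsonDirac ρ V m r) * spinorLift uInv := by
    rw [spinorLift_mul_maskMul, maskMul_mul_spinorLift, wilsonDirac_eq_wilsonDiracG,
      spinorLift_mul_wilsonDiracG ρ uSpin_mul_gamma, Matrix.mul_assoc, h1, Matrix.mul_one]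
  rw [key, det_mul, det_mul, mul_comm (det _) (det (maskMul E _)), mul_assoc, ← det_mul, h1, det_one, mul_one]

/-! ## The reflected bond set -/

omit [NeZero L] [Fact (1 < L)] in
/-- The site reflection on bonds: spatial `(x, k) ↦ (θx, k)`, temporal `(x, 0) ↦ (θ(x + ê₀), 0)`. -/
def reflBond (e : Edge 4 L) : Edge 4 L :=
  if e.2 = 0 then (siteTimeNeg (Site.shift e.1 0), 0) else (siteTimeNeg e.1, e.2)

omit [NeZero L] [Fact (1 < L)] in
/-- `θ(θ(x + ê₀) + ê₀) = x`. -/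
theorem siteTimeNeg_shift_siteTimeNeg_shift (x : TorusSite 4 L) :
    siteTimeNeg (Site.shift (siteTimeNeg (Site.shift x 0)) 0) = x := by
  have h := (siteTimeNeg_eq_shift_iff (siteTimeNeg (Site.shift x 0)) (siteTimeNeg x)).1
    (by rw [siteTimeNeg_involutive, siteTimeNeg_involutive])
  rw [← h, siteTimeNeg_involutive]

omit [NeZero L] [Fact (1 < L)] in
/-- The bond reflection is an involution. -/
theorem reflBond_reflBond (e : Edge 4 L) : reflBond (reflBond e) = e := by
  obtain ⟨x, μ⟩ := e
  unfold reflBond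
  by_cases hμ : μ = 0
  · subst hμ
    simp only [if_true, siteTimeNeg_shift_siteTimeNeg_shift]
  · simp only [hμ, if_false]
    rw [siteTimeNeg_involutive]

omit [Fact (1 < L)] in
/-- The reflected bond set `θE = {b : θb ∈ E}`. -/
def reflBonds (E : Finset (Edge 4 L)) : Finset (Edge 4 L) := Finset.univ.filter fun e => reflBond e ∈ E

omit [Fact (1 < L)] in
/-- Membership in the reflected bond set. -/
@[simp] theorem mem_reflBonds {E : Finset (Edge 4 L)} {e : Edge 4 L} : e ∈ reflBonds E ↔ reflBond e ∈ E := by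
  simp [reflBonds]

omit [Fact (1 < L)] in
/-- `θθE = E`. -/
theorem reflBonds_reflBonds (E : Finset (Edge 4 L)) : reflBonds (reflBonds E) = E := by
  ext e
  rw [mem_reflBonds, mem_reflBonds, reflBond_reflBond]

end Mask

/-- **The mask under the site reflection**: `w_E(θx, θy) = w_{θE}(x, y)`. -/
theorem bondMask_siteTimeNeg {L : ℕ} [NeZero L] (E : Finset (Edge 4 L)) (x y : TorusSite 4 L) :
    bondMask E (siteTimeNeg x) (siteTimeNeg y) = bondMask (reflBonds E) x y := by
  have hinj : ∀ a b : TorusSite 4 L, siteTimeNeg a = siteTimeNeg b → a = b := fun a b h => by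
    rw [← siteTimeNeg_involutive a, h, siteTimeNeg_involutive]
  have key : ((∀ μ, siteTimeNeg y = Site.shift (siteTimeNeg x) μ → (siteTimeNeg x, μ) ∈ E) ∧
      (∀ μ, siteTimeNeg x = Site.shift (siteTimeNeg y) μ → (siteTimeNeg y, μ) ∈ E)) ↔
      ((∀ μ, y = Site.shift x μ → (x, μ) ∈ reflBonds E) ∧ (∀ μ, x = Site.shift y μ → (y, μ) ∈ reflBonds E)) := by
    constructor
    · rintro ⟨H1, H2⟩
      refine ⟨fun μ hμ => ?_, fun μ hμ => ?_⟩
      · rw [mem_reflBonds]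
        unfold reflBond
        by_cases h0 : μ = 0
        · subst h0
          simp only [if_true, ← hμ]
          exact H2 0 ((siteTimeNeg_eq_shift_iff x y).2 hμ)
        · simp only [h0, if_false]
          exact H1 μ (by rw [hμ, siteTimeNeg_shift_of_ne _ h0])
      · rw [mem_reflBonds]
        unfold reflBond
        by_cases h0 : μ = 0
        · subst h0
          simp only [if_true, ← hμ]
          exact H1 0 ((siteTimeNeg_eq_shift_iff y x).2 hμ)
        · simp only [h0, if_false]
          exact H2 μ (by rw [hμ, siteTimeNeg_shift_of_ne _ h0])
    · rintro ⟨G1, G2⟩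
      refine ⟨fun μ hμ => ?_, fun μ hμ => ?_⟩
      · by_cases h0 : μ = 0
        · subst h0
          have hx : x = Site.shift y 0 := (siteTimeNeg_eq_shift_iff y x).1 hμ
          have := G2 0 hx
          rw [mem_reflBonds] at this
          unfold reflBond at this
          simpa only [if_true, ← hx] using this
        · have hy : y = Site.shift x μ := hinj _ _ (by rw [hμ, siteTimeNeg_shift_of_ne _ h0])
          have := G1 μ hy
          rw [mem_reflBonds] at this
          unfold reflBond at this
          simpa only [h0, if_false] using this
      · by_cases h0 : μ = 0
        · subst h0
          have hy : y = Site.shift x 0 := (siteTimeNeg_eq_shift_iff x y).1 hμ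
          have := G1 0 hy
          rw [mem_reflBonds] at this
          unfold reflBond at this
          simpa only [if_true, ← hy] using this
        · have hx : x = Site.shift y μ := hinj _ _ (by rw [hμ, siteTimeNeg_shift_of_ne _ h0])
          have := G2 μ hx
          rw [mem_reflBonds] at this
          unfold reflBond at this
          simpa only [h0, if_false] using this
  unfold bondMask
  rw [if_congr key rfl rfl]


end Summit.QuantumFields.QCD.Theorems.UnquenchedChessboardBoundLine

end
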